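import Literature.Probability.Percolation.GladkovThreeClusterDichotomyProofs
import Summits.CriticalPhenomena.PercolationContinuityZ3.Theorems.PercNearOneGluingNoHeavyLowerTailThreePointHalvingTwoOfThree
import Summits.CriticalPhenomena.PercolationContinuityZ3.Theorems.PercNearOneGluingNoHeavyLowerTailAPLSwitching
import HarnessLib

/-!
# The halving lemma (v) from CONDITION C in Gladkov–Zimin's `S₃` vocabulary (Sahi programme, prover prim-sahi-p2 gen 49)

Support file (`--supports stmt-CriticalPhenomena-4575`, helper).  No definitions, no named facts, no sorries; standard axioms.
Memo `run/shared/lean/prim/prim-sahi/FROM-prim-sahi-p2-gen49-GLADKOV-LP.md`; `prim-sahi-p2/PROOF-E3.md` §59.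

SETTING.  Finite vertex type, edge weights `p_e ∈ [0,1]` (`PrW`, `Pr2W` of `DecisionTreeWeighted`), apex `x` and two further vertices `y, z`
(in the line's notation `x = a`, `y = s`, `z = c`).  Cells: `x|y|z = tri x y z` (`p₀`), `xy|z` (`p₁`), `xz|y` (`p₂`), `x|yz = iso ∖ tri` (`p₃`);
`Ī = iso x y z = {x ↮ y} ∩ {x ↮ z}`, `U = Īᶜ`, `SC = conn y z`.  Gladkov–Zimin's hybrid `H₃(C₁,C₂) = C₁ →_{S₃} C₂ = splice (S3map x y z C₁) C₁ C₂`
keeps the stars of the clusters of `y` and `z` from `C₁` and takes everything else (in particular every pair at the cluster of `x`) from `C₂`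
(GZ24 §4, Gladkov 2024 Fig. 1, tree `Gladkov.S3map`).

RESULTS.
* `mem_cl_splice_S3map` — if `x ↮ y` in `C₁` then the cluster of `y` survives in `H₃`: `cl C₁ y ⊆ cl H₃ y`.
* (used) `APL.Pr2W_tri_S3_conn_le_pairs` — the refined three-point inequality `P(C₁ ∈ x|y|z, H₃ ∈ xy ∪ xz) ≤ μ(xy|z) + μ(xz|y)`
  (Lemma 7.1 + the `S₁`/`S₂` bounds; GZ24's Thm 4.6 is this plus the `S₃` identity and DROPS the mass `P(C₁ ∈ x|y|z, H₃ ∈ xy|z ⊔ xz|y)`).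
* `PrW_iso_mul_PrW_conn_eq` — **the gap identity**: `μ(Ī)·μ(SC) = μ(x|yz) + P(C₁ ∈ x|y|z, H₃ ∈ SC)` (the `S₃` twin of gen 47's resampling identity).
* **`PrW_conn_mul_PrW_iso_le_of_condC`** — CONDITION C `P(C₁ ∈ x|y|z, H₃ ∈ yz|x) ≤ P(C₁ ∈ x|y|z, H₃ ∈ xy|z ⊔ xz|y)` implies
  `μ(SC)·μ(Ī) ≤ μ(xy|z) + μ(xz|y) + μ(x|yz)`, i.e. the halving lemma (v) at the apex `x` in its "`u·I ≤ μ(two blocks)`" form.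
* **`halvingUD_of_condC`** — the same for `prodBernoulli w` in the line's `U·D ≤ 2·(U ∩ D)` form (`U = {s↔a} ∪ {c↔a}`, `D = {s↮c}`).
* `cells_of_halvingUD`, `sac_mul_tri_le_of_halvingUD`, `dichotomy_sq_rate_of_halvingUD` (addendum) — (v) at a graph ⟹ `μ(sac)μ(s|a|c) ≤ 4·max(μ(sa|c),μ(ac|s))`,
  i.e. Gladkov's three-cluster dichotomy (Thm 1.3, printed rate `δ = ε³/4`) with the QUADRATIC rate `δ = ε²/4` on that graph.
So (v) on a weighted graph is reduced to ONE inequality between two transition masses out of `s|a|c` under the SAME measure-preserving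
hybrid: "re-randomising everything off the stars of `C_s`, `C_c` creates `sc|a` no more often than `sa|c ⊔ ac|s`" (law-level condition C of the
gen-48 memo, there written with the swap along `C_a`; the two hybrids have the same joint law with `C₁` on `{C₁ ∈ s|a|c}`).  Numerically the ratio of the two
sides is `≤ 0.115` on all weighted graphs tested (memo §4); its fibrewise form is CONJECTURE C / STRONG-C of gen 48.  Nothing here asserts condition C.
[cite: GladkovZimin2024, §4 (S₁,S₂,S₃; Lemma 4.2; proof of Thm. 4.6), arXiv:2404.08873]; [cite: Gladkov2024, Lemma 3.1, Lemma 7.1, Fig. 1 (arXiv:2408.08457)].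
-/

noncomputable section

namespace Summit.CriticalPhenomena.PercolationContinuityZ3.Theorems

namespace HalvingCondC

open Finset MeasureTheory
open Literature.Probability.Percolation Literature.Probability.Percolation.DecisionTree
open Literature.Probability.Percolation.Gladkov
open Literature.Probability.LatticeModels
open scoped Classical

variable {V : Type*} [Fintype V] [DecidableEq V]

/-- **The cluster of `y` survives in `H₃`.**  If `y ∉ cl C₁ x` then every vertex of `cl C₁ y` lies in the cluster of `y` of
`C₁ →_{S₃} C₂`: the open edges inside `Com_y(C₁)` touch `Com_y` and miss `Com_x`, so they belong to `S₃` and are copied from `C₁`.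
[cite: GladkovZimin2024, §4 ("all internal edges in Com_b and Com_c belong to S₁ and S₃")] -/
theorem mem_cl_splice_S3map {x y z : V} {K₁ K₂ : Finset (Sym2 V)} (hxy : y ∉ cl K₁ x) {v : V} (hv : v ∈ cl K₁ y) :
    v ∈ cl (splice (S3map x y z K₁) K₁ K₂) y := by
  have hyx : x ∉ cl K₁ y := fun h => hxy (mem_cl_comm.1 h)
  have hC : ∀ u u', u ∈ cl K₁ y → (openGraph (↑K₁ : Set (Sym2 V))).Adj u u' → u' ∈ cl K₁ y :=
    fun u u' hu h => mem_cl_of_adj hu h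
  have hGG' : ∀ u u', u ∈ cl K₁ y → (openGraph (↑K₁ : Set (Sym2 V))).Adj u u' →
      (openGraph (↑(splice (S3map x y z K₁) K₁ K₂) : Set (Sym2 V))).Adj u u' := by
    intro u u' hu h
    have hu' : u' ∈ cl K₁ y := hC u u' hu h
    obtain ⟨he, hne⟩ := adj_iff.1 h
    have hS : s(u, u') ∈ S3map x y z K₁ := by
      rw [S3map, Finset.mem_sdiff, mk_mem_touch, mk_mem_touch]
      refine ⟨Or.inl (Finset.mem_union_left _ hu), ?_⟩
      rintro (h1 | h1)
      · exact not_mem_cl_of_mem_cl hu hyx h1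
      · exact not_mem_cl_of_mem_cl hu' hyx h1
    exact adj_iff.2 ⟨(mem_splice_of_mem hS).2 he, hne⟩
  obtain ⟨w⟩ := mem_cl.1 hv
  exact mem_cl.2 (reachable_of_walk hC hGG' w (mem_cl_self K₁ y))

/-- If `C₁ ∈ x|y ∩ x|z` has `y ↔ z` then so does `H₃ = C₁ →_{S₃} C₂`. [cite: GladkovZimin2024, §4] -/
theorem splice_S3map_mem_conn {x y z : V} {K₁ K₂ : Finset (Sym2 V)} (hxy : y ∉ cl K₁ x) (hyz : z ∈ cl K₁ y) :
    splice (S3map x y z K₁) K₁ K₂ ∈ conn y z :=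
  mem_conn_iff_mem_cl.2 (mem_cl_splice_S3map (z := z) (K₂ := K₂) hxy hyz)

section Estimates

variable {p : Sym2 V → ℝ} (hp0 : ∀ e, 0 ≤ p e) (hp1 : ∀ e, p e ≤ 1) (x y z : V)

include hp0 hp1

omit hp0 hp1 in
/-- **The gap identity** (the `S₃` twin of the resampling identity of gen 47): `μ(x|y ∩ x|z)·μ(y ↔ z) = μ(x|yz) + P(C₁ ∈ x|y|z, C₁ →_{S₃} C₂ ∈ {y ↔ z})`.
The `S₃` identity (Lemma 3.1 after exploring `Com_x`) gives `μ(Ī)μ(SC) = P(C₁ ∈ Ī, H₃ ∈ SC)`; on `C₁ ∈ x|yz` the hybrid keeps the `y–z` cluster.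
[cite: GladkovZimin2024, Lemma 4.2, §4]; [this work] -/
theorem PrW_iso_mul_PrW_conn_eq :
    PrW Finset.univ p (iso x y z) * PrW Finset.univ p (conn y z) =
      PrW Finset.univ p (iso x y z \ tri x y z) +
        Pr2W Finset.univ p {w | w.1 ∈ tri x y z ∧ splice (S3map x y z w.1) w.1 w.2 ∈ conn y z} := by
  rw [← Pr2W_iso_S3_eq (p := p) x y z (conn y z)]
  have hsplit : {w : Finset (Sym2 V) × Finset (Sym2 V) | w.1 ∈ iso x y z ∧ splice (S3map x y z w.1) w.1 w.2 ∈ conn y z} =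
      {w | w.1 ∈ iso x y z \ tri x y z} ∪ {w | w.1 ∈ tri x y z ∧ splice (S3map x y z w.1) w.1 w.2 ∈ conn y z} := by
    ext w
    simp only [Set.mem_setOf_eq, Set.mem_union, Set.mem_sdiff]
    constructor
    · rintro ⟨hiso, hconn⟩
      by_cases ht : w.1 ∈ tri x y z
      · exact Or.inr ⟨ht, hconn⟩
      · exact Or.inl ⟨hiso, ht⟩
    · rintro (⟨hiso, ht⟩ | ⟨ht, hconn⟩)
      · refine ⟨hiso, ?_⟩
        -- `w.1 ∈ x|yz`: `z ∈ cl w.1 y`, and the `y–z` cluster survives in `H₃`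
        have hyz : z ∈ cl w.1 y := by
          by_contra hz
          exact ht ⟨hiso.1, hiso.2, fun h => hz (mem_cl_comm.1 h)⟩
        exact splice_S3map_mem_conn hiso.1 hyz
      · exact ⟨tri_subset_iso x y z ht, hconn⟩
  have hdisj : Disjoint {w : Finset (Sym2 V) × Finset (Sym2 V) | w.1 ∈ iso x y z \ tri x y z}
      {w | w.1 ∈ tri x y z ∧ splice (S3map x y z w.1) w.1 w.2 ∈ conn y z} := by
    rw [Set.disjoint_left]
    rintro w ⟨-, ht⟩ ⟨ht', -⟩
    exact ht ht'
  rw [hsplit, Pr2W_union Finset.univ p hdisj, Pr2W_fst]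

/-- **CONDITION C ⟹ THE HALVING LEMMA (v) AT THE APEX `x`** (finite weighted form).  If, out of `x|y|z`, the hybrid `C₁ →_{S₃} C₂` lands in
`yz|x` no more often than in `xy|z ⊔ xz|y`, then `μ(y ↔ z)·μ(x|y ∩ x|z) ≤ μ(xy|z) + μ(xz|y) + μ(x|yz)`.
Proof: gap identity, split `{H₃ ∈ SC} = {H₃ ∈ xyz} ⊔ {H₃ ∈ yz|x}` and `{H₃ ∈ xy ∪ xz} = {H₃ ∈ xyz} ⊔ {H₃ ∈ xy|z ⊔ xz|y}`, then
`APL.Pr2W_tri_S3_conn_le_pairs`. [this work] -/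
theorem PrW_conn_mul_PrW_iso_le_of_condC
    (hC : Pr2W Finset.univ p {w | w.1 ∈ tri x y z ∧
        (z ∈ cl (splice (S3map x y z w.1) w.1 w.2) y ∧ y ∉ cl (splice (S3map x y z w.1) w.1 w.2) x)} ≤
      Pr2W Finset.univ p {w | w.1 ∈ tri x y z ∧
        ((y ∈ cl (splice (S3map x y z w.1) w.1 w.2) x ∧ z ∉ cl (splice (S3map x y z w.1) w.1 w.2) x) ∨
          (z ∈ cl (splice (S3map x y z w.1) w.1 w.2) x ∧ y ∉ cl (splice (S3map x y z w.1) w.1 w.2) x))}) :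
    PrW Finset.univ p (conn y z) * PrW Finset.univ p (iso x y z) ≤
      PrW Finset.univ p {K | y ∈ cl K x ∧ z ∉ cl K x} + PrW Finset.univ p {K | z ∈ cl K x ∧ y ∉ cl K x} +
        PrW Finset.univ p (iso x y z \ tri x y z) := by
  -- notation for the four events of pairs
  set H : Finset (Sym2 V) × Finset (Sym2 V) → Finset (Sym2 V) := fun w => splice (S3map x y z w.1) w.1 w.2 with hH
  set Jev : Set (Finset (Sym2 V) × Finset (Sym2 V)) := {w | w.1 ∈ tri x y z ∧ (y ∈ cl (H w) x ∧ z ∈ cl (H w) x)} with hJev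
  set P3ev : Set (Finset (Sym2 V) × Finset (Sym2 V)) := {w | w.1 ∈ tri x y z ∧ (z ∈ cl (H w) y ∧ y ∉ cl (H w) x)} with hP3ev
  set Xev : Set (Finset (Sym2 V) × Finset (Sym2 V)) := {w | w.1 ∈ tri x y z ∧
      ((y ∈ cl (H w) x ∧ z ∉ cl (H w) x) ∨ (z ∈ cl (H w) x ∧ y ∉ cl (H w) x))} with hXev
  have hC' : Pr2W Finset.univ p P3ev ≤ Pr2W Finset.univ p Xev := hC
  -- `{tri, H ∈ y↔z} = Jev ⊔ P3ev`
  have hSC : {w : Finset (Sym2 V) × Finset (Sym2 V) | w.1 ∈ tri x y z ∧ splice (S3map x y z w.1) w.1 w.2 ∈ conn y z} = Jev ∪ P3ev := by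
    ext w
    simp only [hJev, hP3ev, Set.mem_setOf_eq, Set.mem_union, mem_conn_iff_mem_cl]
    constructor
    · rintro ⟨ht, hyz⟩
      by_cases hyx : y ∈ cl (H w) x
      · refine Or.inl ⟨ht, hyx, ?_⟩
        exact mem_cl.2 ((mem_cl.1 hyx).trans (mem_cl.1 hyz))
      · exact Or.inr ⟨ht, hyz, hyx⟩
    · rintro (⟨ht, hyx, hzx⟩ | ⟨ht, hyz, -⟩)
      · exact ⟨ht, mem_cl.2 ((mem_cl.1 hyx).symm.trans (mem_cl.1 hzx))⟩
      · exact ⟨ht, hyz⟩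
  have hdisj1 : Disjoint Jev P3ev := by
    rw [Set.disjoint_left]
    rintro w ⟨-, hyx, -⟩ ⟨-, -, hyx'⟩
    exact hyx' hyx
  -- `{tri, H ∈ xy ∪ xz} = Jev ⊔ Xev`
  have hU : {w : Finset (Sym2 V) × Finset (Sym2 V) | w.1 ∈ tri x y z ∧ splice (S3map x y z w.1) w.1 w.2 ∈ conn x y ∪ conn x z} = Jev ∪ Xev := by
    ext w
    simp only [hJev, hXev, Set.mem_setOf_eq, Set.mem_union, mem_conn_iff_mem_cl]
    constructor
    · rintro ⟨ht, hu⟩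
      by_cases hyx : y ∈ cl (H w) x <;> by_cases hzx : z ∈ cl (H w) x
      · exact Or.inl ⟨ht, hyx, hzx⟩
      · exact Or.inr ⟨ht, Or.inl ⟨hyx, hzx⟩⟩
      · exact Or.inr ⟨ht, Or.inr ⟨hzx, hyx⟩⟩
      · exact absurd hu (by rintro (h | h) <;> [exact hyx h; exact hzx h])
    · rintro (⟨ht, hyx, -⟩ | ⟨ht, (⟨hyx, -⟩ | ⟨hzx, -⟩)⟩)
      · exact ⟨ht, Or.inl hyx⟩
      · exact ⟨ht, Or.inl hyx⟩
      · exact ⟨ht, Or.inr hzx⟩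
  have hdisj2 : Disjoint Jev Xev := by
    rw [Set.disjoint_left]
    rintro w ⟨-, hyx, hzx⟩ ⟨-, (⟨-, hzx'⟩ | ⟨-, hyx'⟩)⟩
    · exact hzx' hzx
    · exact hyx' hyx
  have hgap := PrW_iso_mul_PrW_conn_eq (p := p) x y z
  rw [hSC, Pr2W_union Finset.univ p hdisj1] at hgap
  have hGZ := APL.Pr2W_tri_S3_conn_le_pairs hp0 hp1 x y z
  rw [hU, Pr2W_union Finset.univ p hdisj2] at hGZ
  rw [mul_comm, hgap]
  linarith

end Estimates

/-! ### Transfer to `prodBernoulli w` and to the line's `U·D ≤ 2·(U ∩ D)` form -/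

/-- **CONDITION C ⟹ (v), `u·I ≤ μ(two blocks)` form, for `prodBernoulli w`.**  With `s, a, c` the line's vertices (apex `a`), if
`P(C₁ ∈ s|a|c, C₁ →_{S₃} C₂ ∈ sc|a) ≤ P(C₁ ∈ s|a|c, C₁ →_{S₃} C₂ ∈ sa|c ⊔ ac|s)` (weights `p_e = w_e`), then
`μ{s↔c}·μ({s↔a}ᶜ ∩ {c↔a}ᶜ) ≤ μ(sa|c) + μ(ac|s) + μ(sc|a)`. [this work] -/
theorem conn_mul_I_le_twoBlocks_of_condC (w : Sym2 V → unitInterval) (s a c : V)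
    (hC : Pr2W Finset.univ (fun e => (w e : ℝ)) {x | x.1 ∈ tri a s c ∧
        (c ∈ cl (splice (S3map a s c x.1) x.1 x.2) s ∧ s ∉ cl (splice (S3map a s c x.1) x.1 x.2) a)} ≤
      Pr2W Finset.univ (fun e => (w e : ℝ)) {x | x.1 ∈ tri a s c ∧
        ((s ∈ cl (splice (S3map a s c x.1) x.1 x.2) a ∧ c ∉ cl (splice (S3map a s c x.1) x.1 x.2) a) ∨
          (c ∈ cl (splice (S3map a s c x.1) x.1 x.2) a ∧ s ∉ cl (splice (S3map a s c x.1) x.1 x.2) a))}) :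
    (prodBernoulli w).real (openConn s c) * (prodBernoulli w).real ((openConn s a)ᶜ ∩ (openConn c a)ᶜ) ≤
      (prodBernoulli w).real (openConn s a ∩ (openConn s c)ᶜ) + (prodBernoulli w).real (openConn c a ∩ (openConn c s)ᶜ) +
        (prodBernoulli w).real (openConn s c ∩ (openConn s a)ᶜ) := by
  set p : Sym2 V → ℝ := fun e => (w e : ℝ) with hp
  have hp0 : ∀ e, 0 ≤ p e := fun e => (w e).2.1
  have hp1 : ∀ e, p e ≤ 1 := fun e => (w e).2.2
  have hdet : ∀ C : Set (BondConfig V), DeterminedBy C (↑(Finset.univ : Finset (Sym2 V)) : Set (Sym2 V)) := by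
    intro C
    rw [determinedBy_iff]
    intro ω ω' h
    rw [Finset.coe_univ, Set.inter_univ, Set.inter_univ] at h
    rw [h]
  have hcl : ∀ (S : Finset (Sym2 V)) (u v : V), (↑S : Set (Sym2 V)) ∈ openConn u v ↔ v ∈ cl S u :=
    fun S u v => by rw [mem_cl]; rfl
  have e1 : (prodBernoulli w).real ((openConn a s)ᶜ ∩ (openConn a c)ᶜ) = PrW Finset.univ p (iso a s c) :=
    prodBernoulli_real_eq_PrW w (hdet _) fun S _ => by
      simp only [iso, Set.mem_setOf_eq, Set.mem_inter_iff, Set.mem_compl_iff, hcl]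
  have e2 : (prodBernoulli w).real (openConn s c) = PrW Finset.univ p (conn s c) :=
    prodBernoulli_real_eq_PrW w (hdet _) fun S _ => by
      simp only [mem_conn_iff_mem_cl, hcl]
  have e3 : (prodBernoulli w).real (openConn a s ∩ (openConn a c)ᶜ) = PrW Finset.univ p {K | s ∈ cl K a ∧ c ∉ cl K a} :=
    prodBernoulli_real_eq_PrW w (hdet _) fun S _ => by
      simp only [Set.mem_setOf_eq, Set.mem_inter_iff, Set.mem_compl_iff, hcl]
  have e4 : (prodBernoulli w).real (openConn a c ∩ (openConn a s)ᶜ) = PrW Finset.univ p {K | c ∈ cl K a ∧ s ∉ cl K a} :=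
    prodBernoulli_real_eq_PrW w (hdet _) fun S _ => by
      simp only [Set.mem_setOf_eq, Set.mem_inter_iff, Set.mem_compl_iff, hcl]
  have e5 : (prodBernoulli w).real ((openConn a s)ᶜ ∩ (openConn a c)ᶜ ∩ openConn s c) = PrW Finset.univ p (iso a s c \ tri a s c) :=
    prodBernoulli_real_eq_PrW w (hdet _) fun S _ => by
      simp only [iso, tri, Set.mem_sdiff, Set.mem_setOf_eq, Set.mem_inter_iff, Set.mem_compl_iff, hcl, not_and, not_not]
      constructor
      · rintro ⟨⟨h1, h2⟩, h3⟩
        exact ⟨⟨h1, h2⟩, mem_cl_comm.1 (h3 h1 h2)⟩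
      · rintro ⟨⟨h1, h2⟩, h3⟩
        exact ⟨⟨h1, h2⟩, fun _ _ => mem_cl_comm.1 h3⟩
  have key := PrW_conn_mul_PrW_iso_le_of_condC hp0 hp1 a s c hC
  rw [← e1, ← e2, ← e3, ← e4, ← e5] at key
  rw [openConn_comm a s, openConn_comm a c, HalvingTwoOfThree.sa_inter_compl_ca, HalvingTwoOfThree.ca_inter_compl_sa,
    HalvingTwoOfThree.I_inter_sc] at key
  exact key

/-- **CONDITION C ⟹ THE HALVING LEMMA (v)**: under the same hypothesis, `μ(U)·μ(D) ≤ 2·μ(U ∩ D)` with `U = {s↔a} ∪ {c↔a}`, `D = {s↮c}`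
(cell algebra: `μ(U)μ(D) − 2μ(U∩D) = μ{s↔c}·μ(Ī) − μ(sa|c) − μ(ac|s) − μ(sc|a)`). [this work] -/
theorem halvingUD_of_condC (w : Sym2 V → unitInterval) (s a c : V)
    (hC : Pr2W Finset.univ (fun e => (w e : ℝ)) {x | x.1 ∈ tri a s c ∧
        (c ∈ cl (splice (S3map a s c x.1) x.1 x.2) s ∧ s ∉ cl (splice (S3map a s c x.1) x.1 x.2) a)} ≤
      Pr2W Finset.univ (fun e => (w e : ℝ)) {x | x.1 ∈ tri a s c ∧
        ((s ∈ cl (splice (S3map a s c x.1) x.1 x.2) a ∧ c ∉ cl (splice (S3map a s c x.1) x.1 x.2) a) ∨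
          (c ∈ cl (splice (S3map a s c x.1) x.1 x.2) a ∧ s ∉ cl (splice (S3map a s c x.1) x.1 x.2) a))}) :
    (prodBernoulli w).real (openConn s a ∪ openConn c a) * (prodBernoulli w).real ((openConn s c)ᶜ) ≤
      2 * (prodBernoulli w).real ((openConn s a ∪ openConn c a) ∩ (openConn s c)ᶜ) := by
  have hmain := conn_mul_I_le_twoBlocks_of_condC w s a c hC
  set μ := prodBernoulli w with hμ
  have hX : μ.real ((openConn s a ∪ openConn c a) ∩ (openConn s c)ᶜ) =
      μ.real (openConn s a ∩ (openConn s c)ᶜ) + μ.real (openConn c a ∩ (openConn c s)ᶜ) := by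
    rw [HalvingTransplant.inter_D_eq_union, measureReal_union (HalvingTransplant.disjoint_pairSep s a c) MeasurableSet.of_discrete]
  have hUc : μ.real (openConn s a ∪ openConn c a) = 1 - μ.real ((openConn s a)ᶜ ∩ (openConn c a)ᶜ) := by
    rw [← Set.compl_union, measureReal_compl MeasurableSet.of_discrete, probReal_univ]
    ring
  have hI : μ.real ((openConn s a)ᶜ ∩ (openConn c a)ᶜ) =
      μ.real (openConn s c ∩ (openConn s a)ᶜ) + μ.real ((openConn s a)ᶜ ∩ (openConn s c)ᶜ ∩ (openConn c a)ᶜ) := by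
    rw [← HalvingTwoOfThree.I_diff_sc s a c, ← HalvingTwoOfThree.I_inter_sc s a c,
      Set.inter_comm ((openConn s a)ᶜ ∩ (openConn c a)ᶜ) (openConn s c),
      ← Set.inter_comm ((openConn s a)ᶜ ∩ (openConn c a)ᶜ) (openConn s c)]
    rw [show ((openConn s a)ᶜ ∩ (openConn c a)ᶜ ∩ openConn s c : Set (BondConfig V)) =
        ((openConn s a)ᶜ ∩ (openConn c a)ᶜ) ∩ openConn s c from rfl]
    exact (measureReal_inter_add_sdiff₀ (μ := μ) (s := (openConn s a)ᶜ ∩ (openConn c a)ᶜ) (t := openConn s c)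
      (MeasurableSet.of_discrete).nullMeasurableSet).symm
  have hD : μ.real ((openConn s c)ᶜ) =
      μ.real ((openConn s a ∪ openConn c a) ∩ (openConn s c)ᶜ) + μ.real ((openConn s a)ᶜ ∩ (openConn s c)ᶜ ∩ (openConn c a)ᶜ) := by
    rw [← HalvingTransplant.D_diff_U_eq_Z0 s a c, Set.inter_comm (openConn s a ∪ openConn c a),
      ← measureReal_inter_add_sdiff₀ (μ := μ) (s := (openConn s c)ᶜ) (t := openConn s a ∪ openConn c a)
      (MeasurableSet.of_discrete).nullMeasurableSet]
    congr 2
  have hu : μ.real (openConn s c) = 1 - μ.real ((openConn s c)ᶜ) := by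
    rw [measureReal_compl MeasurableSet.of_discrete, probReal_univ]
    ring
  -- algebra: `I = P3 + P0`, `μ(U) = 1 - I`, `μ(D) = X + P0`, `u = 1 - μ(D)`; `u·I ≤ X + P3 ⟹ (1 - I)(X + P0) ≤ 2X`.
  set X := μ.real ((openConn s a ∪ openConn c a) ∩ (openConn s c)ᶜ)
  set I := μ.real ((openConn s a)ᶜ ∩ (openConn c a)ᶜ)
  set P0 := μ.real ((openConn s a)ᶜ ∩ (openConn s c)ᶜ ∩ (openConn c a)ᶜ)
  set P3 := μ.real (openConn s c ∩ (openConn s a)ᶜ)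
  have hu' : μ.real (openConn s c) = 1 - (X + P0) := by rw [hu, hD]
  rw [hu', hI] at hmain
  rw [hUc, hD, hI]
  have halg : (1 - (P3 + P0)) * (X + P0) = (1 - (X + P0)) * (P3 + P0) + X - P3 := by ring
  rw [halg]
  linarith [hmain, hX]

/-! ### The halving lemma as the quadratic-rate form of Gladkov's three-cluster dichotomy (gen 49 addendum) -/

omit [DecidableEq V] in
/-- **Cell form of (v) from its `U·D` form** (pure cell algebra, no hypothesis on the graph): if `μ(U)·μ(D) ≤ 2·μ(U ∩ D)` then
`T·p₀ ≤ (1 + p₃)·(p₁ + p₂)` with `T = μ({s↔a} ∩ {s↔c})`, `p₀ = μ(s|a|c)`, `p₁ = μ(sa|c)`, `p₂ = μ(ac|s)`, `p₃ = μ(sc|a)`. [this work] -/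
theorem cells_of_halvingUD (w : Sym2 V → unitInterval) (s a c : V)
    (hUD : (prodBernoulli w).real (openConn s a ∪ openConn c a) * (prodBernoulli w).real ((openConn s c)ᶜ) ≤
      2 * (prodBernoulli w).real ((openConn s a ∪ openConn c a) ∩ (openConn s c)ᶜ)) :
    (prodBernoulli w).real (openConn s a ∩ openConn s c) *
        (prodBernoulli w).real ((openConn s a)ᶜ ∩ (openConn s c)ᶜ ∩ (openConn c a)ᶜ) ≤
      (1 + (prodBernoulli w).real (openConn s c ∩ (openConn s a)ᶜ)) *
        ((prodBernoulli w).real (openConn s a ∩ (openConn s c)ᶜ) + (prodBernoulli w).real (openConn c a ∩ (openConn c s)ᶜ)) := by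
  set μ := prodBernoulli w with hμ
  have hX : μ.real ((openConn s a ∪ openConn c a) ∩ (openConn s c)ᶜ) =
      μ.real (openConn s a ∩ (openConn s c)ᶜ) + μ.real (openConn c a ∩ (openConn c s)ᶜ) := by
    rw [HalvingTransplant.inter_D_eq_union, measureReal_union (HalvingTransplant.disjoint_pairSep s a c) MeasurableSet.of_discrete]
  have hU : μ.real (openConn s a ∪ openConn c a) =
      μ.real ((openConn s a ∪ openConn c a) ∩ (openConn s c)ᶜ) + μ.real (openConn s a ∩ openConn s c) := by
    rw [← HalvingTransplant.inter_Dc_eq_J s a c,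
      ← measureReal_inter_add_sdiff₀ (μ := μ) (s := openConn s a ∪ openConn c a) (t := (openConn s c)ᶜ)
      (MeasurableSet.of_discrete).nullMeasurableSet]
    congr 2
    ext ω; simp only [Set.mem_sdiff, Set.mem_compl_iff, not_not, Set.mem_inter_iff]
  have hD : μ.real ((openConn s c)ᶜ) =
      μ.real ((openConn s a ∪ openConn c a) ∩ (openConn s c)ᶜ) + μ.real ((openConn s a)ᶜ ∩ (openConn s c)ᶜ ∩ (openConn c a)ᶜ) := by
    rw [← HalvingTransplant.D_diff_U_eq_Z0 s a c, Set.inter_comm (openConn s a ∪ openConn c a),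
      ← measureReal_inter_add_sdiff₀ (μ := μ) (s := (openConn s c)ᶜ) (t := openConn s a ∪ openConn c a)
      (MeasurableSet.of_discrete).nullMeasurableSet]
    congr 2
  have hDc : μ.real ((openConn s c)ᶜ) =
      1 - (μ.real (openConn s a ∩ openConn s c) + μ.real (openConn s c ∩ (openConn s a)ᶜ)) := by
    rw [measureReal_compl MeasurableSet.of_discrete, probReal_univ]
    congr 1
    conv_lhs => rw [HalvingTransplant.openConn_eq_J_union_SC s a c]
    rw [measureReal_union _ MeasurableSet.of_discrete]
    rw [Set.disjoint_left]
    rintro ω ⟨hsa, -⟩ ⟨-, hna⟩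
    exact hna hsa
  set X := μ.real ((openConn s a ∪ openConn c a) ∩ (openConn s c)ᶜ)
  set T := μ.real (openConn s a ∩ openConn s c)
  set P0 := μ.real ((openConn s a)ᶜ ∩ (openConn s c)ᶜ ∩ (openConn c a)ᶜ)
  set P3 := μ.real (openConn s c ∩ (openConn s a)ᶜ)
  have hX0 : 0 ≤ X := measureReal_nonneg
  rw [← hX]
  rw [hU, hD] at hUD
  have hD' : X + P0 = 1 - (T + P3) := by rw [← hD, hDc]
  nlinarith [hUD, hX0, hD']

omit [DecidableEq V] in
/-- **(v) is the quadratic-rate form of Gladkov's Theorem 1.3.**  On a weighted graph where the halving lemma holds at the apex `a`,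
`μ(sac)·μ(s|a|c) ≤ 4·max(μ(sa|c), μ(ac|s))` (indeed `≤ 2·(μ(sa|c)+μ(ac|s))`); so `μ(sa|c), μ(ac|s) < δ := ε²/4` forces `μ(sac) < ε` or `μ(s|a|c) < ε`,
against the printed rate `δ < ε³/4` (Gladkov 2024 §7.2; tree `gladkov2024_thm_1_3_rate`).  Conditional on (v) at this graph; nothing here asserts (v).
[cite: Gladkov2024, Thm. 1.3 and §7.2 (arXiv:2408.08457)] [this work] -/
theorem sac_mul_tri_le_of_halvingUD (w : Sym2 V → unitInterval) (s a c : V)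
    (hUD : (prodBernoulli w).real (openConn s a ∪ openConn c a) * (prodBernoulli w).real ((openConn s c)ᶜ) ≤
      2 * (prodBernoulli w).real ((openConn s a ∪ openConn c a) ∩ (openConn s c)ᶜ)) :
    (prodBernoulli w).real (openConn s a ∩ openConn s c) *
        (prodBernoulli w).real ((openConn s a)ᶜ ∩ (openConn s c)ᶜ ∩ (openConn c a)ᶜ) ≤
      4 * max ((prodBernoulli w).real (openConn s a ∩ (openConn s c)ᶜ)) ((prodBernoulli w).real (openConn c a ∩ (openConn c s)ᶜ)) := by
  have h := cells_of_halvingUD w s a c hUD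
  set μ := prodBernoulli w
  have hP3 : μ.real (openConn s c ∩ (openConn s a)ᶜ) ≤ 1 := measureReal_le_one
  have h1 : 0 ≤ μ.real (openConn s a ∩ (openConn s c)ᶜ) := measureReal_nonneg
  have h2 : 0 ≤ μ.real (openConn c a ∩ (openConn c s)ᶜ) := measureReal_nonneg
  have hm1 : μ.real (openConn s a ∩ (openConn s c)ᶜ) ≤
      max (μ.real (openConn s a ∩ (openConn s c)ᶜ)) (μ.real (openConn c a ∩ (openConn c s)ᶜ)) := le_max_left _ _
  have hm2 : μ.real (openConn c a ∩ (openConn c s)ᶜ) ≤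
      max (μ.real (openConn s a ∩ (openConn s c)ᶜ)) (μ.real (openConn c a ∩ (openConn c s)ᶜ)) := le_max_right _ _
  nlinarith [h, hP3, h1, h2, hm1, hm2]

omit [DecidableEq V] in
/-- **ε–δ reading**: on a weighted graph satisfying (v) at `a`, if `μ(sa|c) < δ`, `μ(ac|s) < δ` and `δ ≤ ε²/4` (`0 < ε`), then `μ(sac) < ε` or `μ(s|a|c) < ε`.
[cite: Gladkov2024, Thm. 1.3] [this work] -/
theorem dichotomy_sq_rate_of_halvingUD (w : Sym2 V → unitInterval) (s a c : V) {ε δ : ℝ} (hε : 0 < ε) (hδ : δ ≤ ε ^ 2 / 4)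
    (hUD : (prodBernoulli w).real (openConn s a ∪ openConn c a) * (prodBernoulli w).real ((openConn s c)ᶜ) ≤
      2 * (prodBernoulli w).real ((openConn s a ∪ openConn c a) ∩ (openConn s c)ᶜ))
    (h1 : (prodBernoulli w).real (openConn s a ∩ (openConn s c)ᶜ) < δ)
    (h2 : (prodBernoulli w).real (openConn c a ∩ (openConn c s)ᶜ) < δ) :
    (prodBernoulli w).real (openConn s a ∩ openConn s c) < ε ∨
      (prodBernoulli w).real ((openConn s a)ᶜ ∩ (openConn s c)ᶜ ∩ (openConn c a)ᶜ) < ε := by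
  have h := sac_mul_tri_le_of_halvingUD w s a c hUD
  set μ := prodBernoulli w
  by_contra hcon
  rw [not_or, not_lt, not_lt] at hcon
  obtain ⟨hT, hP0⟩ := hcon
  have hmax : max (μ.real (openConn s a ∩ (openConn s c)ᶜ)) (μ.real (openConn c a ∩ (openConn c s)ᶜ)) < δ := max_lt h1 h2
  have hεε : ε * ε ≤ μ.real (openConn s a ∩ openConn s c) * μ.real ((openConn s a)ᶜ ∩ (openConn s c)ᶜ ∩ (openConn c a)ᶜ) :=
    mul_le_mul hT hP0 hε.le measureReal_nonneg
  nlinarith [h, hmax, hεε, hδ, sq_nonneg ε]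

end HalvingCondC

end Summit.CriticalPhenomena.PercolationContinuityZ3.Theorems

end
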